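import Mathlib
import HarnessLib
import Literature.MathematicalPhysics.QuantumFieldTheory.ConstructiveQFTWave0
import Summits.Ventures.LatticeQCDFlow.Scaling.Conjectures
import Summits.Ventures.LatticeQCDFlow.Scaling.LatticeActionLevelSets
import Summits.Ventures.LatticeQCDFlow.Scaling.LatticeEntropy
import Summits.Ventures.LatticeQCDFlow.Scaling.LatticePeeling
import Summits.Ventures.LatticeQCDFlow.Scaling.LatticeGibbs
import Summits.Ventures.LatticeQCDFlow.Scaling.LatticeEntropyGrowth
import Summits.Ventures.LatticeQCDFlow.Scaling.LatticeTreeGauge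
import Summits.Ventures.LatticeQCDFlow.Scaling.LatticeEntropyGrowthSharp

/-!
# LatticeQCDFlow / Scaling — the Laplace half-mass law (Gβ) PROVED from the one-plaquette inputs

HONEST FRAMING: exact (Metropolis-corrected) sampling algorithms for lattice gauge theory; figures of merit are
autocorrelation/cost numbers at stated couplings and volumes; no continuum-physics claim.

Venture `LatticeQCDFlow` (cell pub-lqcd), topic `Scaling`, FANOUT row 30 (lean-1) — OUR WORK.  The conjecture item
`Conjectures.LaplaceHalfMass d N G ρ nTr` ((Gβ), `Scaling/Conjectures.lean`, THEORY-2.md §3.2: "uniformly in the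
volume, at weak coupling the Wilson law puts half of its mass on a set of product-Haar measure
`≤ (c₀/β)^{n_tr(L)/2}`") is PROVED here, for every compact second-countable `G` and continuous `ρ` with
`Re tr ρ ≤ N` satisfying the two one-plaquette inputs of the entropy-growth law — (H1) `Z₁(β) ≤ A·β^{-κ/2}`
(`β > 0`) and (H2) small balls of Haar mass `≥ a·ε^κ` with four-fold action `≤ b·ε²` — with the transverse
count

  `nTr(L) = κ·((d-1)·L^d·(1 - 3/L) - 2)`,

i.e. the sharp `κ·(d-1)·L^d` up to the `O(1/L)` boundary slack of the peeling bound (`theorem laplaceHalfMass`).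
The set is the sub-level set `E = {S ≤ s₀(β, L)}` of the Wilson action.  PROOF (three Chernoff / Markov
steps on top of theory-2's kernel-checked bounds on `Z_Λ`):
(1) `W_β(S > s₀) ≤ e^{-βs₀/2}·Z_Λ(β/2)` (`e^{-βS} ≤ e^{-βs₀/2}e^{-βS/2}` off `E`), so `μ_β(E) ≥ 1/2` as soon as
    `e^{-βs₀/2}·Z_Λ(β/2) ≤ Z_Λ(β)/2`;
(2) `Z_Λ(β/2) ≤ (A·(β/2)^{-κ/2})^m`, `m = (d-1)L^{d-1}(L-1)` (PEELING `peelingBound` + (H1)) and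
    `Z_Λ(β) ≥ (a·β^{-κ/2})^{n}·e^{-b·#P}`, `n = #E - (#V - 1) ≤ (d-1)L^d + 1` (TREE GAUGE `treeGaugeSmallBallBound`
    + (H2) at `ε = β^{-1/2}`) fix `s₀ := (2/β)·(log 2 + log UB(β/2) - log LB(β))`;
(3) `Haar^{⊗E}(E) ≤ e^{βs₀}·Z_Λ(β) ≤ 4·UB(β/2)²·UB(β)/LB(β)² = e^{O(L^d)}·β^{-κ(3m/2 - n)}` and
    `κ(3m/2 - n) ≥ nTr(L)/2`; the `e^{O(L^d)}` is absorbed into `c₀^{nTr/2}` (`nTr ≥ κ·L^d/8` once `nTr > 0`,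
    which forces `d ≥ 2`, `L ≥ 4`), and for `nTr(L) ≤ 0` (`L ≤ 3` or `d ≤ 1` or `κ = 0`) `E = univ` does it
    (`β ≥ β₀ ≥ c₀`).
Instances with NO hypothesis left (`U(1)`: κ = 1; `U(N)`: κ = N²; `SU(N)`: κ = N²-1) follow in
`Scaling/LatticeLaplaceHalfMassInstances.lean` from the proved inputs of `LatticeEntropyU1/UN/SUNLaw`.  With
`Barriers.ConcentrationBudget` / `Theory2.map_apply_le_of_preimage_le` (tree) this is the unconditional form of
the (Gβ) entropy barrier: any flow from the Haar prior whose push-forward has ESS bounded below must contract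
log-volume by `≥ (nTr/2)·log(β/c₀)`.  Elementary given the tree; nothing here is cited as a fact.
-/

noncomputable section

namespace Summit.Ventures.LatticeQCDFlow.Theory2.Lattice

open MeasureTheory Set Literature.MathematicalPhysics.QuantumFieldTheory

section LHM

variable {N : ℕ} {G : Type} [Group G] [TopologicalSpace G] [IsTopologicalGroup G]
  [CompactSpace G] [SecondCountableTopology G] [MeasurableSpace G] [BorelSpace G]
  (ρ : G →* Matrix (Fin N) (Fin N) ℂ)

/-- **(Gβ) LAPLACE HALF-MASS LAW, PROVED from the one-plaquette inputs** (OURS; closes the instance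
`nTr(L) = κ·((d-1)·L^d·(1 - 3/L) - 2)` of the conjecture item `Conjectures.LaplaceHalfMass`): for a compact
second-countable `G`, continuous `ρ` with `Re tr ρ ≤ N`, (H1) and (H2) with exponent `κ`, there are `c₀ > 0`,
`β₀ > 0` such that for every `L` and every `β ≥ β₀` the sub-level set `E = {S ≤ s₀(β,L)}` of the Wilson action
has `μ_{Λ,β}(E) ≥ 1/2` and `Haar^{⊗E}(E) ≤ (c₀/β)^{nTr(L)/2}`. [folklore] -/
theorem laplaceHalfMass (d : ℕ) (κ : ℝ) (hρ : Continuous (ρ : G → Matrix (Fin N) (Fin N) ℂ))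
    (htr : ∀ g, (ρ g).trace.re ≤ N)
    (hH1 : ∃ A : ℝ, ∀ β : ℝ, 0 < β → onePlaquetteZ ρ β ≤ A * β ^ (-(κ / 2)))
    (hH2 : ∃ a b : ℝ, 0 < a ∧ ∀ ε : ℝ, 0 < ε → ε ≤ 1 → ∃ B : Set G, MeasurableSet B ∧
        a * ε ^ κ ≤ (haarProbability G B).toReal ∧
        ∀ g₁ ∈ insert (1 : G) (B ∪ B⁻¹), ∀ g₂ ∈ insert (1 : G) (B ∪ B⁻¹),
          ∀ g₃ ∈ insert (1 : G) (B ∪ B⁻¹), ∀ g₄ ∈ insert (1 : G) (B ∪ B⁻¹),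
            (N : ℝ) - (ρ (g₁ * g₂ * g₃ * g₄)).trace.re ≤ b * ε ^ 2) :
    Conjectures.LaplaceHalfMass d N G ρ
      (fun L => κ * (((d : ℝ) - 1) * (L : ℝ) ^ d * (1 - 3 / L) - 2)) := by
  obtain ⟨A, hA⟩ := hH1
  obtain ⟨a, b, ha, hab⟩ := hH2
  have hκ : 0 ≤ κ := nonneg_of_smallBalls (G := G) ha fun ε hε0 hε1 => by
    obtain ⟨B, -, hB, -⟩ := hab ε hε0 hε1
    exact ⟨B, hB⟩
  have hApos : 0 < A := by
    have h := hA 1 one_pos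
    rw [Real.one_rpow, mul_one] at h
    exact lt_of_lt_of_le (onePlaquetteZ_pos ρ hρ htr 1 zero_le_one) h
  have hb : 0 ≤ b := by
    obtain ⟨B, -, -, hB⟩ := hab 1 one_pos le_rfl
    have h := hB 1 (Set.mem_insert _ _) 1 (Set.mem_insert _ _) 1 (Set.mem_insert _ _)
      1 (Set.mem_insert _ _)
    simpa using h
  have hlog2 : 0 < Real.log 2 := Real.log_pos one_lt_two
  -- the constants
  set C' : ℝ := 2 * Real.log 2 + 3 * d * |Real.log A| + d * κ * Real.log 2 + 2 * d * |Real.log a| +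
    2 * b * (d : ℝ) ^ 2 with hC'
  have hC'0 : 0 ≤ C' := by positivity
  set c₀ : ℝ := Real.exp (16 * C' / κ) with hc₀
  have hc₀pos : 0 < c₀ := Real.exp_pos _
  have hlogc₀ : Real.log c₀ = 16 * C' / κ := Real.log_exp _
  unfold Conjectures.LaplaceHalfMass
  beta_reduce
  refine ⟨c₀, hc₀pos, max c₀ 2, lt_max_of_lt_right two_pos, fun L _ β hβ => ?_⟩
  have hβc : c₀ ≤ β := le_trans (le_max_left _ _) hβ
  have hβ2 : 2 ≤ β := le_trans (le_max_right _ _) hβ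
  have hβ0 : 0 < β := by linarith only [hβ2]
  have hβ1 : 1 ≤ β := by linarith only [hβ2]
  have hlogβ : 0 ≤ Real.log β := Real.log_nonneg hβ1
  have hL1nat : 1 ≤ L := NeZero.one_le
  have hL1 : (1 : ℝ) ≤ L := by exact_mod_cast hL1nat
  have hL0 : (0 : ℝ) < L := by linarith only [hL1]
  have hLd : (0 : ℝ) < (L : ℝ) ^ d := by positivity
  have hLd1 : (1 : ℝ) ≤ (L : ℝ) ^ d := one_le_pow₀ hL1
  set q : ℝ := ((d : ℝ) - 1) * (L : ℝ) ^ d * (1 - 3 / L) - 2 with hq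
  have hZ0 : partitionFunction (d := d) (L := L) ρ β ≠ 0 := partitionFunction_ne_zero ρ hρ β
  have hZtop : partitionFunction (d := d) (L := L) ρ β ≠ ⊤ :=
    ne_top_of_le_ne_top ENNReal.one_ne_top (partitionFunction_le_one ρ htr hβ0.le)
  by_cases hnT : κ * q ≤ 0
  · -- trivial branch: `E = univ`, `(c₀/β)^{κq/2} ≥ 1`
    haveI : IsProbabilityMeasure (wilsonMeasure (d := d) (L := L) ρ β) := ⟨by
      show ((partitionFunction ρ β)⁻¹ • wilsonWeight ρ β) Set.univ = 1
      rw [Measure.smul_apply, smul_eq_mul]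
      exact ENNReal.inv_mul_cancel hZ0 hZtop⟩
    refine ⟨Set.univ, MeasurableSet.univ, ?_, ?_⟩
    · rw [measure_univ]; exact ENNReal.inv_le_one.2 one_le_two
    · rw [measure_univ]
      have h1 : (1 : ℝ) ≤ (c₀ / β) ^ (κ * q / 2) :=
        Real.one_le_rpow_of_pos_of_le_one_of_nonpos (by positivity) ((div_le_one hβ0).2 hβc)
          (by linarith only [hnT])
      exact ENNReal.one_le_ofReal.2 h1
  -- main branch: `κ > 0`, `q > 0`, hence `d ≥ 2`, `L ≥ 4`
  rw [not_le] at hnT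
  have hκpos : 0 < κ := by
    rcases hκ.eq_or_lt with h | h
    · rw [← h, zero_mul] at hnT; exact absurd hnT (lt_irrefl 0)
    · exact h
  have hqpos : 0 < q := pos_of_mul_pos_right hnT hκ
  have hd2 : 2 ≤ d := by
    by_contra hlt
    have hd01 : d = 0 ∨ d = 1 := by omega
    rcases hd01 with hd | hd
    · have h3 : (3 : ℝ) / L ≤ 3 := by rw [div_le_iff₀ hL0]; linarith only [hL1]
      have : q ≤ 0 := by
        rw [hq, hd]; simp only [Nat.cast_zero, zero_sub, pow_zero]; linarith only [h3]
      linarith only [this, hqpos]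
    · have : q ≤ 0 := by
        rw [hq, hd]; simp only [Nat.cast_one, sub_self, zero_mul, zero_sub]; norm_num
      linarith only [this, hqpos]
  have hd1nat : 1 ≤ d := by omega
  have hd0 : d ≠ 0 := by omega
  have hd2r : (2 : ℝ) ≤ d := by exact_mod_cast hd2
  have hdm1 : (1 : ℝ) ≤ (d : ℝ) - 1 := by linarith only [hd2r]
  have hL4 : 4 ≤ L := by
    by_contra hlt
    rw [not_le] at hlt
    have hL3 : (L : ℝ) ≤ 3 := by exact_mod_cast (by omega : L ≤ 3)
    have h13 : 1 - 3 / (L : ℝ) ≤ 0 := by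
      rw [sub_nonpos, le_div_iff₀ hL0]; linarith only [hL3]
    have hprod : ((d : ℝ) - 1) * (L : ℝ) ^ d * (1 - 3 / L) ≤ 0 :=
      mul_nonpos_of_nonneg_of_nonpos (by positivity) h13
    have : q ≤ 0 := by rw [hq]; linarith only [hprod]
    linarith only [this, hqpos]
  have hL4r : (4 : ℝ) ≤ L := by exact_mod_cast hL4
  -- `q ≥ L^d / 8`
  have hq_ge : (L : ℝ) ^ d / 8 ≤ q := by
    have h13 : (1 : ℝ) / 4 ≤ 1 - 3 / (L : ℝ) := by
      have : (3 : ℝ) / L ≤ 3 / 4 := div_le_div_of_nonneg_left (by norm_num) (by norm_num) hL4r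
      linarith only [this]
    have h16 : (16 : ℝ) ≤ (L : ℝ) ^ d :=
      calc (16 : ℝ) = 4 ^ 2 := by norm_num
        _ ≤ (4 : ℝ) ^ d := pow_le_pow_right₀ (by norm_num) hd2
        _ ≤ (L : ℝ) ^ d := pow_le_pow_left₀ (by norm_num) hL4r d
    have h1 : (L : ℝ) ^ d * (1 / 4) ≤ ((d : ℝ) - 1) * (L : ℝ) ^ d * (1 - 3 / L) :=
      calc (L : ℝ) ^ d * (1 / 4) = 1 * (L : ℝ) ^ d * (1 / 4) := by ring
        _ ≤ ((d : ℝ) - 1) * (L : ℝ) ^ d * (1 - 3 / L) := by gcongr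
    rw [hq]; linarith only [h1, h16]
  -- the ball at scale `ε = β^{-1/2}`
  set ε : ℝ := β ^ (-(1 / 2 : ℝ)) with hε
  have hε0 : 0 < ε := Real.rpow_pos_of_pos hβ0 _
  have hε1 : ε ≤ 1 := Real.rpow_le_one_of_one_le_of_nonpos hβ1 (by norm_num)
  obtain ⟨B, hBm, hBa, hBs⟩ := hab ε hε0 hε1
  have hε2 : β * (b * ε ^ 2) = b := by
    have h2 : ε ^ 2 = β⁻¹ := by
      rw [hε, ← Real.rpow_natCast (β ^ (-(1 / 2 : ℝ))) 2, ← Real.rpow_mul hβ0.le]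
      norm_num [Real.rpow_neg_one]
    rw [h2]
    field_simp
  have haε : 0 < a * ε ^ κ := mul_pos ha (Real.rpow_pos_of_pos hε0 κ)
  have hHpos : 0 < (haarProbability G B).toReal := lt_of_lt_of_le haε hBa
  have f5 : Real.log a - κ / 2 * Real.log β ≤ Real.log (haarProbability G B).toReal := by
    have h := Real.log_le_log haε hBa
    rw [Real.log_mul ha.ne' (Real.rpow_pos_of_pos hε0 κ).ne', Real.log_rpow hε0, hε,
      Real.log_rpow hβ0] at h
    linarith only [h]
  -- cardinalities
  have hV : Fintype.card (Site d L) = L ^ d := by simp [ZMod.card, Fintype.card_fin]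
  have hEn : Fintype.card (Edge d L) = L ^ d * d := by
    simp [Fintype.card_prod, ZMod.card, Fintype.card_fin]
  have hE : (Fintype.card (Edge d L) : ℝ) = d * (L : ℝ) ^ d := by
    rw [hEn]; push_cast; ring
  have hP : (Fintype.card (Plaquette d L) : ℝ) ≤ (d : ℝ) ^ 2 * (L : ℝ) ^ d := by
    have h1 : Fintype.card (Plaquette d L) =
        L ^ d * Fintype.card {p : Fin d × Fin d // p.1 < p.2} := by
      simp [Fintype.card_prod, ZMod.card, Fintype.card_fin]
    have h2 : Fintype.card {p : Fin d × Fin d // p.1 < p.2} ≤ d * d :=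
      (Fintype.card_subtype_le _).trans (by simp)
    have h3 : (Fintype.card (Plaquette d L) : ℝ) ≤ (L : ℝ) ^ d * (d * d : ℝ) := by
      rw [h1]; push_cast; gcongr; exact_mod_cast h2
    nlinarith [h3]
  have hP0 : (0 : ℝ) ≤ Fintype.card (Plaquette d L) := Nat.cast_nonneg _
  set n : ℕ := Fintype.card (Edge d L) - (Fintype.card (Site d L) - 1) with hn
  have hn0 : (0 : ℝ) ≤ n := Nat.cast_nonneg _
  have hnE : (n : ℝ) ≤ d * (L : ℝ) ^ d := by
    rw [← hE]; exact_mod_cast (by rw [hn]; exact Nat.sub_le _ _ : n ≤ Fintype.card (Edge d L))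
  have hP' : (L : ℝ) ^ d = (L : ℝ) ^ (d - 1) * L := (pow_sub_one_mul hd0 (L : ℝ)).symm
  have hn_sharp : (n : ℝ) ≤ ((d : ℝ) - 1) * (L : ℝ) ^ d + 1 := by
    have hk : 1 ≤ L ^ d := Nat.one_le_pow _ _ (by omega)
    have h1 : L ^ d - 1 ≤ L ^ d * d :=
      (Nat.sub_le _ _).trans (by simpa using Nat.mul_le_mul_left (L ^ d) hd1nat)
    have h2 : (n : ℝ) = (L : ℝ) ^ d * d - ((L : ℝ) ^ d - 1) := by
      rw [hn, hEn, hV, Nat.cast_sub h1, Nat.cast_sub hk]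
      push_cast
      ring
    rw [h2]; apply le_of_eq; ring
  set m : ℕ := (d - 1) * L ^ (d - 1) * (L - 1) with hm
  have hm0 : (0 : ℝ) ≤ m := Nat.cast_nonneg _
  have hm_eq : (m : ℝ) = ((d : ℝ) - 1) * (L : ℝ) ^ (d - 1) * ((L : ℝ) - 1) := by
    rw [hm]; push_cast [Nat.cast_sub hd1nat, Nat.cast_sub hL1nat]; ring
  have hLdm1 : (0 : ℝ) ≤ (L : ℝ) ^ (d - 1) := by positivity
  have hm_le : (m : ℝ) ≤ d * (L : ℝ) ^ d := by
    have h : m ≤ d * L ^ d :=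
      calc m = (d - 1) * L ^ (d - 1) * (L - 1) := rfl
        _ ≤ d * L ^ (d - 1) * L := by gcongr <;> omega
        _ = d * L ^ d := by rw [mul_assoc, pow_sub_one_mul hd0]
    exact_mod_cast h
  -- the exponent bookkeeping: `n - 3m/2 ≤ -q/2`
  have hq' : q = ((d : ℝ) - 1) * (L : ℝ) ^ (d - 1) * ((L : ℝ) - 3) - 2 := by
    rw [hq, hP']; field_simp
  have hexp : (n : ℝ) - 3 * m / 2 ≤ -q / 2 := by
    rw [hP'] at hn_sharp
    calc (n : ℝ) - 3 * m / 2
        ≤ ((d : ℝ) - 1) * ((L : ℝ) ^ (d - 1) * L) + 1 -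
            3 * (((d : ℝ) - 1) * (L : ℝ) ^ (d - 1) * ((L : ℝ) - 1)) / 2 := by
          rw [← hm_eq]; linarith only [hn_sharp]
      _ = -q / 2 := by rw [hq']; ring
  -- the kernel-checked bounds on the partition functions
  have hZpos : 0 < (partitionFunction (d := d) (L := L) ρ β).toReal := ENNReal.toReal_pos hZ0 hZtop
  have hZh0 : partitionFunction (d := d) (L := L) ρ (β / 2) ≠ 0 := partitionFunction_ne_zero ρ hρ (β / 2)
  have hZhtop : partitionFunction (d := d) (L := L) ρ (β / 2) ≠ ⊤ :=
    ne_top_of_le_ne_top ENNReal.one_ne_top (partitionFunction_le_one ρ htr (by positivity))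
  have hZhpos : 0 < (partitionFunction (d := d) (L := L) ρ (β / 2)).toReal := ENNReal.toReal_pos hZh0 hZhtop
  have hL2 : 2 ≤ L := by omega
  -- (1) tree-gauged small balls at `β`: `LB ≤ log Z(β)`
  have f1 : (n : ℝ) * (Real.log a - κ / 2 * Real.log β) - b * Fintype.card (Plaquette d L) ≤
      Real.log (partitionFunction (d := d) (L := L) ρ β).toReal := by
    have hSB := treeGaugeSmallBallBound d N G ρ hρ htr L β hβ0.le B hBm (b * ε ^ 2) hBs
    rw [hε2, ← hn] at hSB
    have hpos : 0 < (haarProbability G B).toReal ^ n *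
        Real.exp (-(b * Fintype.card (Plaquette d L))) := by positivity
    have h := Real.log_le_log hpos hSB
    rw [Real.log_mul (pow_pos hHpos _).ne' (Real.exp_pos _).ne', Real.log_pow, Real.log_exp] at h
    have g5 : (n : ℝ) * (Real.log a - κ / 2 * Real.log β) ≤ n * Real.log (haarProbability G B).toReal :=
      mul_le_mul_of_nonneg_left f5 hn0
    linarith only [h, g5]
  -- (2) peeling + (H1) at `β/2` and at `β`
  have f3a : Real.log (partitionFunction (d := d) (L := L) ρ (β / 2)).toReal ≤
      m * Real.log (onePlaquetteZ ρ (β / 2)) := by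
    have h := Real.log_le_log hZhpos (peelingBound d N G ρ hρ htr L hL2 (β / 2) (by positivity))
    rwa [Real.log_pow] at h
  have f3b : Real.log (partitionFunction (d := d) (L := L) ρ β).toReal ≤
      m * Real.log (onePlaquetteZ ρ β) := by
    have h := Real.log_le_log hZpos (peelingBound d N G ρ hρ htr L hL2 β hβ0.le)
    rwa [Real.log_pow] at h
  have hβh : 0 < β / 2 := by positivity
  have f4a : Real.log (onePlaquetteZ ρ (β / 2)) ≤ Real.log A - κ / 2 * (Real.log β - Real.log 2) := by
    have h := Real.log_le_log (onePlaquetteZ_pos ρ hρ htr (β / 2) hβh.le) (hA (β / 2) hβh)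
    rw [Real.log_mul hApos.ne' (Real.rpow_pos_of_pos hβh _).ne', Real.log_rpow hβh,
      Real.log_div hβ0.ne' two_ne_zero] at h
    linarith only [h]
  have f4b : Real.log (onePlaquetteZ ρ β) ≤ Real.log A - κ / 2 * Real.log β := by
    have h := Real.log_le_log (onePlaquetteZ_pos ρ hρ htr β hβ0.le) (hA β hβ0)
    rw [Real.log_mul hApos.ne' (Real.rpow_pos_of_pos hβ0 _).ne', Real.log_rpow hβ0] at h
    linarith only [h]
  have g34a : (m : ℝ) * Real.log (onePlaquetteZ ρ (β / 2)) ≤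
      m * (Real.log A - κ / 2 * (Real.log β - Real.log 2)) := mul_le_mul_of_nonneg_left f4a hm0
  have g34b : (m : ℝ) * Real.log (onePlaquetteZ ρ β) ≤ m * (Real.log A - κ / 2 * Real.log β) :=
    mul_le_mul_of_nonneg_left f4b hm0
  have f3 : Real.log (partitionFunction (d := d) (L := L) ρ (β / 2)).toReal ≤
      m * (Real.log A - κ / 2 * (Real.log β - Real.log 2)) := f3a.trans g34a
  have f3' : Real.log (partitionFunction (d := d) (L := L) ρ β).toReal ≤
      m * (Real.log A - κ / 2 * Real.log β) := f3b.trans g34b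
  -- the level `s₀`
  set UBh : ℝ := m * (Real.log A - κ / 2 * (Real.log β - Real.log 2)) with hUBh
  set LB : ℝ := (n : ℝ) * (Real.log a - κ / 2 * Real.log β) - b * Fintype.card (Plaquette d L) with hLB
  set s₀ : ℝ := 2 / β * (Real.log 2 + UBh - LB) with hs₀
  have hβs₀ : β * s₀ / 2 = Real.log 2 + UBh - LB := by rw [hs₀]; field_simp
  -- half mass
  have hhalf : Real.exp (-(β * s₀ / 2)) * (partitionFunction (d := d) (L := L) ρ (β / 2)).toReal ≤
      (partitionFunction (d := d) (L := L) ρ β).toReal / 2 := by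
    have h1 : -(β * s₀ / 2) + Real.log (partitionFunction (d := d) (L := L) ρ (β / 2)).toReal ≤
        Real.log (partitionFunction (d := d) (L := L) ρ β).toReal - Real.log 2 := by
      rw [hβs₀]; linarith only [f3, f1]
    have h2 := Real.exp_le_exp.2 h1
    rwa [Real.exp_add, Real.exp_log hZhpos, Real.exp_sub, Real.exp_log hZpos, Real.exp_log two_pos] at h2
  refine ⟨{U | wilsonAction ρ U ≤ s₀}, measurableSet_action_le ρ hρ s₀,
    half_le_wilsonMeasure_le ρ hρ htr hβ0.le s₀ hhalf, ?_⟩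
  -- small prior mass
  have key : Real.exp (β * s₀) * (partitionFunction (d := d) (L := L) ρ β).toReal ≤
      (c₀ / β) ^ (κ * q / 2) := by
    rw [Real.rpow_def_of_pos (by positivity), Real.log_div hc₀pos.ne' hβ0.ne', hlogc₀,
      ← Real.exp_log hZpos, ← Real.exp_add]
    apply Real.exp_le_exp.2
    -- `β s₀ + log Z(β) ≤ (16C'/κ - log β)·(κq/2)`
    have hβs₀' : β * s₀ = 2 * (Real.log 2 + UBh - LB) := by linarith only [hβs₀]
    rw [hβs₀', hUBh, hLB]
    have e1 : (16 * C' / κ - Real.log β) * (κ * q / 2) = 8 * C' * q - κ * q / 2 * Real.log β := by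
      field_simp
      ring
    rw [e1]
    -- β-dependent terms
    have gexp : κ * Real.log β * ((n : ℝ) - 3 * m / 2) ≤ κ * Real.log β * (-q / 2) :=
      mul_le_mul_of_nonneg_left hexp (mul_nonneg hκ hlogβ)
    -- constant terms ≤ C'·L^d ≤ 8·C'·q
    have gC : C' * (L : ℝ) ^ d ≤ 8 * C' * q := by
      have h := mul_le_mul_of_nonneg_left hq_ge hC'0
      linarith only [h]
    have gm1 : (m : ℝ) * Real.log A ≤ d * (L : ℝ) ^ d * |Real.log A| :=
      (mul_le_mul_of_nonneg_left (le_abs_self _) hm0).trans (mul_le_mul_of_nonneg_right hm_le (abs_nonneg _))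
    have gm2 : (m : ℝ) * (κ * Real.log 2) ≤ d * (L : ℝ) ^ d * (κ * Real.log 2) :=
      mul_le_mul_of_nonneg_right hm_le (mul_nonneg hκ hlog2.le)
    have ga1 : -((n : ℝ) * Real.log a) ≤ d * (L : ℝ) ^ d * |Real.log a| := by
      have h1 : -((n : ℝ) * Real.log a) ≤ n * |Real.log a| := by
        rw [← mul_neg]; exact mul_le_mul_of_nonneg_left (neg_le_abs _) hn0
      exact h1.trans (mul_le_mul_of_nonneg_right hnE (abs_nonneg _))
    have gP : b * (Fintype.card (Plaquette d L) : ℝ) ≤ b * ((d : ℝ) ^ 2 * (L : ℝ) ^ d) :=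
      mul_le_mul_of_nonneg_left hP hb
    have gl2 : 2 * Real.log 2 ≤ 2 * Real.log 2 * (L : ℝ) ^ d := by nlinarith only [hLd1, hlog2]
    have hC'L : C' * (L : ℝ) ^ d = 2 * Real.log 2 * (L : ℝ) ^ d + 3 * (d * (L : ℝ) ^ d * |Real.log A|) +
        d * (L : ℝ) ^ d * (κ * Real.log 2) + 2 * (d * (L : ℝ) ^ d * |Real.log a|) +
        2 * (b * ((d : ℝ) ^ 2 * (L : ℝ) ^ d)) := by rw [hC']; ring
    linarith only [gexp, gC, gm1, gm2, ga1, gP, gl2, hC'L, f3']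
  calc Measure.pi (fun _ : Edge d L => haarProbability G) {U | wilsonAction ρ U ≤ s₀}
      ≤ ENNReal.ofReal (Real.exp (β * s₀)) * partitionFunction (d := d) (L := L) ρ β := pi_le_le ρ hρ hβ0.le s₀
    _ = ENNReal.ofReal (Real.exp (β * s₀) * (partitionFunction (d := d) (L := L) ρ β).toReal) := by
        rw [ENNReal.ofReal_mul (Real.exp_pos _).le, ENNReal.ofReal_toReal hZtop]
    _ ≤ ENNReal.ofReal ((c₀ / β) ^ (κ * q / 2)) := ENNReal.ofReal_le_ofReal key

end LHM

end Summit.Ventures.LatticeQCDFlow.Theory2.Lattice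

end
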